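import Summits.CriticalPhenomena.PercolationContinuityZ3.Theorems.Transplant.BoxProdZ2ConcRealised
import Summits.CriticalPhenomena.PercolationContinuityZ3.Theorems.Transplant.KNCells2AnchorNormO
import Summits.CriticalPhenomena.PercolationContinuityZ3.Theorems.Transplant.KNCells2AnchorNorm
import Summits.CriticalPhenomena.PercolationContinuityZ3.Theorems.Transplant.SkelConcSchedule
import Summits.CriticalPhenomena.PercolationContinuityZ3.Theorems.Transplant.SkelConcRealised
import Literature.Probability.Percolation.OrientedHistorySiteRenormalizationRun
import HarnessLib

/-!
# N2 (frames-only node `SamePDropOfSkeletonFrm₁`, OPEN) — ORIENTED MACRO LAYER (WAVE 0 (c1), (R-18) `q ≡ true`): the oriented twin of N1's `SkelConcRealised`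

builds on p205010 (kernel theorem, internal audit signed; external expert review pending) — nothing in this file uses p205010; NOTHING is claimed about the
open node `SamePDropOfSkeletonFrm₁` (`SamePDropOfSkeletonNeg₁` is CLOSED in the tree and untouched by this file).
Status sentence (coordinator 2026-08-20T04:30Z): "θ(p_c) = 0 on ℤ^d, all d ≥ 2 — kernel-verified (Lean 4/Mathlib, standard axioms); internal adversarial
audit SIGNED 2026-08-20 04:29Z; external expert review pending."
Lane `prim-bschramm`, seat `prim-hp-8` (gen 40) with stmt-g19's tool of record; helper file (`--supports stmt-CriticalPhenomena-4575 --as helper`); N2-SCOPE §20, (R-18)/(R-19).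
PORT RULES (HOME/prim-bschramm-stmt-g19/lean/port_orient.py): the history-site API is replaced by its ORIENTED twin at the fixed quadrant `qNE := fun _ => true`
(`HState.choice ↦ HState.ochoice qNE`, `mstOf ↦ omstOf qNE`, `mst/stN ↦ omst/ostN qNE`, `occFinal ↦ ooccFinal qNE`, `Lawful ↦ OLawful qNE`, onward directions
`onward ↦ onwardO` = the POSITIVE ones, (N2-e)); every declaration whose text changes thereby — directly or through a changed declaration — is re-declared with the
suffix `O` (same namespace); unchanged declarations of the N1 file are NOT repeated (the N1 module is imported). Docstrings/citations are N1's.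
hp-8 g40 (p5-g15 00:22:21Z 'yours'): ONLY §1 (the scheme-generic lemmas read by the (F) face column's SkelPhiFaceRunNbS); §2–§3 (the product-node geometry) are off N2's path.
N1 HEADER (kept for the reader):
* `Skel.realised_of_choice` — for ANY `S : KSchA V ℕ` with the re-centring rule `anchor a v P = a + 1`, `a₀ = 0`: the anchors
  `(aOf₁, aOf₂)` of a chosen edge and its target cell are `BoxProdZ2.Realised` (the product's proof, verbatim over `V`);
* `Skel.l1_tgt_le_nQ` — `‖tgt e‖₁ ≤ nQ (aOf₁) (tgt e)` at every chosen edge (p2-g3's `KNCells2AnchorNorm` in the form p2-g3's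
  `Skel.concRadiiS_rQ_eq_of_norm_le` consumes: the position-inflated cube radius is INACTIVE at every run pair);
* for the scheme `⟨Skel.cellGeomSG Φ C t Λ, q, δc⟩` (stmt-g7's `SkelConc.concSchemeSG`, an `abbrev` — everything here is stated for the
  literal structure and transfers by `rfl`): `Skel.cellGeomSG_anchor`, `Skel.cellGeomSG_a₀`, **`Skel.tgt_add_stepVec_ne_zero`** (onward
  targets of a valid history are never the root cell, given `Φ.φ t = 0`), `Skel.realised_of_choice_SG`.
[cite: KozmaNitzan2024, §4 pp. 25–27 (the exploration process)]
-/
noncomputable section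

open scoped Classical

namespace Summit.CriticalPhenomena.PercolationContinuityZ3.Theorems

namespace Transplant

namespace Skel

open Literature.Probability.Percolation Literature.Probability.LatticeModels SimpleGraph GadgetSystem Contour KNCells
open Literature.Probability.Percolation.KozmaNitzan.Cells (stepVec_apply_fst stepVec_apply_oth)
open BoxProdZ2 (Realised ConcRadiiG nQ nS gen0 Erad Frad gen0_stepVec gen0_stepVec_add_stepVec)

variable {V : Type} [DecidableEq V] {G : SimpleGraph V} [G.LocallyFinite]

/-! ## §1 Any unit-increment scheme -/

/-- **The anchors of a CHOSEN edge are realised** — generic over the vertex type and over every anchored-cells scheme with the unit-increment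
re-centring rule (the product's `BoxProdZ2.realised_of_choice`, whose proof used nothing else). [folklore] -/
theorem realised_of_choiceO [Countable V] {S : KSchA V ℕ} (hanch : ∀ a v P, S.Γ.anchor a v P = a + 1) (h0 : S.Γ.a₀ = 0)
    (h : ProbeHistory V) {e : Site 2 × MDir} (hc : (S.astOf₂O G h).st.ochoice KSchA.qNE = some e) :
    Realised (S.aOf₁O G h e) (S.aOf₂O G h e) (tgt e) := by
  have hx : tgt e ≠ 0 := KSchA.tgt_ne_zero_of_choiceO h hc
  rcases KSchA.anchors_of_choice_succO hanch h0 h hc with hβ | ⟨he1, hα, hβ⟩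
  · by_cases hα : S.aOf₁O G h e = 0
    · have h1 : S.aOf₂O G h e = 1 := by rw [hβ, hα]
      obtain ⟨d, hd⟩ := KSchA.src_eq_step_of_choice_dep_oneO hanch h0 h h1
      refine Or.inr (Or.inl ⟨hα, h1, hx, d, e.2, ?_⟩)
      show e.1 + stepVec e.2 = stepVec d + stepVec e.2
      rw [hd]; show (0 + stepVec d) + stepVec e.2 = stepVec d + stepVec e.2; rw [zero_add]
    · exact Or.inl ⟨hβ, Nat.one_le_iff_ne_zero.2 hα⟩
  · refine Or.inr (Or.inr ⟨hα, hβ, e.2, ?_⟩)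
    show e.1 + stepVec e.2 = stepVec e.2
    rw [he1, zero_add]

/-- **The planar ℓ¹-position of the examined cell is dominated by its cube level**: `‖tgt e‖₁ ≤ nQ (aOf₁O) (tgt e)` at every chosen edge
(`‖tgt e‖₁ ≤ aOf₁O + 2` from `KNCells2AnchorNorm`; for `aOf₁O = 0` the target has generation `≤ 2`, so `gen0 = ‖·‖₁`). This is the hypothesis
of `Skel.concRadiiS_rQ_eq_of_norm_le`: the max-inflated cube radius of the generic schedule is inactive at every run pair. [folklore] -/
theorem l1_tgt_le_nQO [Countable V] {S : KSchA V ℕ} (hanch : ∀ a v P, S.Γ.anchor a v P = a + 1) (h0 : S.Γ.a₀ = 0)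
    (h : ProbeHistory V) {e : Site 2 × MDir} (hc : (S.astOf₂O G h).st.ochoice KSchA.qNE = some e) :
    (tgt e 0).natAbs + (tgt e 1).natAbs ≤ nQ (S.aOf₁O G h e) (tgt e) := by
  have h2 := KSchA.norm_tgt_le_aOf₁_add_twoO hanch h0 h hc
  unfold l1 at h2
  unfold nQ
  split_ifs with hα
  · rw [hα] at h2
    unfold gen0
    omega
  · omega

/-! ## §2 The generation of the examined cube (generic) -/

/-- **At a chosen edge the examined cube is one generation above the source's own level**: `nQ α (tgt e) = nS α e.1 + 1` for EVERY
unit-increment scheme (the oriented product's replay; generic in the cell geometry). [folklore] -/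
theorem nQ_tgt_eq_nS_src_succO [Countable V] {S : KSchA V ℕ} (hanch : ∀ a v P, S.Γ.anchor a v P = a + 1) (h0 : S.Γ.a₀ = 0)
    (h : ProbeHistory V) {e : Site 2 × MDir} (hc : (S.astOf₂O G h).st.ochoice KSchA.qNE = some e) :
    nQ (S.aOf₁O G h e) (tgt e) = nS (S.aOf₁O G h e) e.1 + 1 := by
  set α := S.aOf₁O G h e with hα
  by_cases hα0 : α = 0
  · rw [hα0, nQ, nS, if_pos rfl, if_pos rfl]
    rcases KSchA.anchors_of_choice_succO hanch h0 h hc with hβ | ⟨he1, -, -⟩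
    · have hβ1 : S.aOf₂O G h e = 1 := by rw [hβ, ← hα, hα0]
      obtain ⟨d, hd⟩ := KSchA.src_eq_step_of_choice_dep_oneO hanch h0 h hβ1
      have he1 : e.1 = stepVec d := by rw [hd]; simp [GadgetSystem.tgt]
      have hne : e.1 ≠ 0 := by rw [he1]; exact stepVec_ne_zero d
      have hx : tgt e = stepVec d + stepVec e.2 := by simp [GadgetSystem.tgt, he1]
      rw [if_neg hne, hx, gen0_stepVec_add_stepVec (by rw [← hx]; exact KSchA.tgt_ne_zero_of_choiceO h hc)]
    · rw [if_pos he1, show tgt e = stepVec e.2 by simp [GadgetSystem.tgt, he1], gen0_stepVec]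
  · rw [nQ, nS, if_neg hα0, if_neg hα0]

end Skel
end Transplant
end Summit.CriticalPhenomena.PercolationContinuityZ3.Theorems
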